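import Summits.ResolutionOfSingularities.ResolutionOfSingularities.Theorems.FrobeniusLadderFRationalResolutionFixedPointFibre
import Mathlib.RingTheory.Ideal.GoingUp
import Mathlib.RingTheory.Localization.Ideal
import Mathlib.RingTheory.Localization.AtPrime.Basic
import Mathlib.RingTheory.LocalRing.MaximalIdeal.Basic
import HarnessLib

/-!
# Crux `FrobeniusLadder.FRationalResolution` (stmt-ResolutionOfSingularities-15317), line `redirect`,
# stub `stub_diagonalizableQuotientResolution` — at a `D(A)`-FIXED point the base change
# `S ⊗_{S₀} (S₀)_𝔮` is LOCAL and is `S_𝔔` (linearisation step L3, third brick)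

For `S` graded by a torsion abelian group `A` (`GradedAlgebra 𝒮`, `S₀ = 𝒮 0`) and a prime `𝔔` of `S`
containing every piece `S_a`, `a ≠ 0` (a fixed point of the `D(A)`-action, `…FixedPointFibre.lean`),
with contraction `𝔮 = 𝔔 ∩ S₀`:

* `le_of_under_le_of_fixed` — **every prime `P` of `S` with `P ∩ S₀ ⊆ 𝔮` lies inside `𝔔`**
  (going up along the integral extension `S₀ ⊆ S` to a prime over `𝔮`, which is `𝔔` by
  `FixedPointFibre.eq_of_isPrime_of_comap_eq`);
* `isLocalRing_localization_of_fixed`, `maximalIdeal_localization_of_fixed` — the localization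
  `T⁻¹S`, `T = S₀ ∖ 𝔮` (i.e. `S ⊗_{S₀} (S₀)_𝔮`, the quotient chart seen from the local ring of
  `Spec S₀` at the image of the fixed point) is a LOCAL ring with maximal ideal `𝔔 · T⁻¹S`;
* `isLocalization_atPrime_of_fixed` — and it is the local ring `S_𝔔` (`IsLocalization.AtPrime`).

With `…FixedPointGenerators.lean` (homogeneous generators of `𝔔 S_𝔔`) and
`…AdjoinParameters.lean` (Nakayama: `S_𝔔 = (S₀)_𝔮[x₁,…,x_n]`) this is the set-up of Kato's
log-regularity of the quotient chart at a fixed point. Honest label: elementary brick of L3 (no stub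
closed). No definitions, no named facts, no sorry. [folklore; cite: SGA3, Exp. VIII §4–5]
[cite: Matsumura1987, Thm. 9.4 (going up)]
-/

noncomputable section

-- single-problem summit: the doubled namespace component is forced
set_option linter.dupNamespace false

open DirectSum IsLocalRing
open Literature.AlgebraicGeometry.Resolution.DiagonalizableQuotient

namespace Summit.ResolutionOfSingularities.ResolutionOfSingularities.Theorems.FRationalResolution.FixedPointLocal

universe u v w

variable {R : Type u} {S : Type v} {A : Type w} [CommRing R] [CommRing S] [Algebra R S]
  [DecidableEq A] [AddCommGroup A] (𝒮 : A → Submodule R S) [GradedAlgebra 𝒮]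

/-- **Primes under a fixed prime.** If `𝔔 ⊇ S_a` for all `a ≠ 0` (torsion grading) then every prime
`P` of `S` whose contraction to `S₀` is contained in `𝔔 ∩ S₀` is contained in `𝔔`: by going up
along the integral extension `S₀ ⊆ S` there is a prime `P' ⊇ P` lying over `𝔔 ∩ S₀`, and the only
such prime is `𝔔`. [folklore; cite: Matsumura1987, Thm. 9.4] -/
theorem le_of_under_le_of_fixed (hA : AddMonoid.IsTorsion A) (𝔔 : Ideal S) [𝔔.IsPrime]
    (hfix : ∀ a : A, a ≠ 0 → ∀ s ∈ 𝒮 a, s ∈ 𝔔) (P : Ideal S)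
    (hP : P.comap (algebraMap (𝒮 0) S) ≤ 𝔔.comap (algebraMap (𝒮 0) S)) : P ≤ 𝔔 := by
  haveI := algebra_isIntegral 𝒮 hA
  obtain ⟨P', hPP', hP'prime, hP'⟩ :=
    Ideal.exists_ideal_over_prime_of_isIntegral (𝔔.comap (algebraMap (𝒮 0) S)) P hP
  haveI := hP'prime
  have h := FixedPointFibre.eq_of_isPrime_of_comap_eq 𝒮 hA 𝔔 P' hfix hP'.symm
  rw [h]
  exact hPP'

section Localized

variable (hA : AddMonoid.IsTorsion A) (𝔔 : Ideal S) [𝔔.IsPrime]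
  (hfix : ∀ a : A, a ≠ 0 → ∀ s ∈ 𝒮 a, s ∈ 𝔔)
  (L : Type v) [CommRing L] [Algebra S L]
  [IsLocalization ((𝔔.comap (algebraMap (𝒮 0) S)).primeCompl.map (algebraMap (𝒮 0) S)) L]

/-- `𝔔` does not meet `T = S₀ ∖ 𝔮`. [folklore] -/
theorem disjoint_map_primeCompl :
    Disjoint (((𝔔.comap (algebraMap (𝒮 0) S)).primeCompl.map (algebraMap (𝒮 0) S) : Submonoid S) :
      Set S) (𝔔 : Set S) := by
  rw [Set.disjoint_left]
  rintro _ ⟨r, hr, rfl⟩ hrQ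
  exact hr hrQ

include hA hfix in
/-- Every prime of `T⁻¹S` lies inside `𝔔 · T⁻¹S`. [folklore] -/
theorem le_map_of_isPrime (𝔓 : Ideal L) [𝔓.IsPrime] : 𝔓 ≤ 𝔔.map (algebraMap S L) := by
  set M := (𝔔.comap (algebraMap (𝒮 0) S)).primeCompl.map (algebraMap (𝒮 0) S) with hM
  have hdisj := ((IsLocalization.isPrime_iff_isPrime_disjoint M L 𝔓).mp ‹_›).2
  have hle : (𝔓.comap (algebraMap S L)).comap (algebraMap (𝒮 0) S) ≤
      𝔔.comap (algebraMap (𝒮 0) S) := by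
    intro r hr
    by_contra hrq
    have hmem : algebraMap (𝒮 0) S r ∈ M := Submonoid.mem_map_of_mem _ hrq
    exact Set.disjoint_left.mp hdisj hmem hr
  have hPQ : 𝔓.comap (algebraMap S L) ≤ 𝔔 := le_of_under_le_of_fixed 𝒮 hA 𝔔 hfix _ hle
  calc 𝔓 = (𝔓.comap (algebraMap S L)).map (algebraMap S L) :=
        (IsLocalization.map_under M L 𝔓).symm
    _ ≤ 𝔔.map (algebraMap S L) := Ideal.map_mono hPQ

include hA hfix in
/-- **`T⁻¹S` is local**, `T = S₀ ∖ (𝔔 ∩ S₀)`, with `𝔔 T⁻¹S` its only maximal ideal. [folklore] -/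
theorem isLocalRing_localization_of_fixed : IsLocalRing L := by
  set M := (𝔔.comap (algebraMap (𝒮 0) S)).primeCompl.map (algebraMap (𝒮 0) S) with hM
  have hprime : (𝔔.map (algebraMap S L)).IsPrime :=
    IsLocalization.isPrime_of_isPrime_disjoint M L 𝔔 ‹_› (disjoint_map_primeCompl 𝒮 𝔔)
  have hmax : (𝔔.map (algebraMap S L)).IsMaximal := by
    refine ⟨⟨hprime.ne_top, fun J hJ => ?_⟩⟩
    by_contra hJtop
    obtain ⟨𝔓, h𝔓max, hJ𝔓⟩ := Ideal.exists_le_maximal J hJtop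
    haveI := h𝔓max.isPrime
    exact (lt_irrefl J) (lt_of_le_of_lt (hJ𝔓.trans (le_map_of_isPrime 𝒮 hA 𝔔 hfix L 𝔓)) hJ)
  refine IsLocalRing.of_unique_max_ideal ⟨𝔔.map (algebraMap S L), hmax, fun I hI => ?_⟩
  haveI := hI.isPrime
  exact hI.eq_of_le hmax.ne_top (le_map_of_isPrime 𝒮 hA 𝔔 hfix L I)

include hA hfix in
/-- The maximal ideal of the local ring `T⁻¹S` is `𝔔 T⁻¹S`. [folklore] -/
theorem maximalIdeal_localization_of_fixed :
    haveI := isLocalRing_localization_of_fixed 𝒮 hA 𝔔 hfix L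
    maximalIdeal L = 𝔔.map (algebraMap S L) := by
  haveI := isLocalRing_localization_of_fixed 𝒮 hA 𝔔 hfix L
  set M := (𝔔.comap (algebraMap (𝒮 0) S)).primeCompl.map (algebraMap (𝒮 0) S) with hM
  have hprime : (𝔔.map (algebraMap S L)).IsPrime :=
    IsLocalization.isPrime_of_isPrime_disjoint M L 𝔔 ‹_› (disjoint_map_primeCompl 𝒮 𝔔)
  apply le_antisymm
  · exact le_map_of_isPrime 𝒮 hA 𝔔 hfix L _
  · exact IsLocalRing.le_maximalIdeal hprime.ne_top

include hA hfix in
/-- **`T⁻¹S = S_𝔔`**: the localization of `S` at `T = S₀ ∖ (𝔔 ∩ S₀)` is already the local ring of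
`S` at the fixed prime `𝔔` (every element of `S ∖ 𝔔` is a unit of the local ring `T⁻¹S`, whose
maximal ideal contracts to `𝔔`). [folklore] -/
theorem isLocalization_atPrime_of_fixed : IsLocalization.AtPrime L 𝔔 := by
  haveI := isLocalRing_localization_of_fixed 𝒮 hA 𝔔 hfix L
  set M := (𝔔.comap (algebraMap (𝒮 0) S)).primeCompl.map (algebraMap (𝒮 0) S) with hM
  refine IsLocalization.of_le M 𝔔.primeCompl ?_ ?_
  · rintro _ ⟨r, hr, rfl⟩
    exact hr
  · intro s hs
    by_contra hunit
    have hmem : algebraMap S L s ∈ maximalIdeal L := (mem_maximalIdeal _).mpr hunit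
    rw [maximalIdeal_localization_of_fixed 𝒮 hA 𝔔 hfix L] at hmem
    exact hs ((IsLocalization.under_map_of_isPrime_disjoint M L ‹𝔔.IsPrime›
      (disjoint_map_primeCompl 𝒮 𝔔)).le hmem)

end Localized

end Summit.ResolutionOfSingularities.ResolutionOfSingularities.Theorems.FRationalResolution.FixedPointLocal

end
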